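import Summits.CriticalPhenomena.PercolationContinuityZ3.Theorems.PercNearOneGluingNoHeavyLowerTailSahiPolyReflectList
import Summits.CriticalPhenomena.PercolationContinuityZ3.Theorems.PercNearOneGluingNoHeavyLowerTailSparseBernsteinCert
import HarnessLib

/-!
# `NoHeavyLowerTail` (stmt-CriticalPhenomena-4575) — box positivity of a sparse integer polynomial by PRUNED RECURSIVE BERNSTEIN SLICING
# with a monomial-domination leaf test (plain-list terms, fast under native compilation)

Support file, seat `prim-l12-p5` (gen 10), `--supports stmt-CriticalPhenomena-4575`.  Standard axioms; computable list operations; no sorries,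
no `native_decide` in this file (users run `boxcheckK` by `native_decide` in `--computational` certificate files).

THE CHECKER.  Terms are `(c, [e_0,…])` (coefficient, exponent list; `evalKL` of `…SahiPolyReflectFast` evaluates them in `k` real variables,
missing exponents read as `0`).  For a list `vs` of (variable, degree) pairs, `boxcheckK vs L` decides a SUFFICIENT condition for
`0 ≤ evalKL k L x` on the unit box `[0,1]^k`:
* leaf test `dominatedK L` — greedy MONOMIAL DOMINATION: every negative term `−a·x^e` is paid for by positive budget taken from terms `+b·x^{e'}`
  with `e' ≤ e` pointwise (then `x^{e} ≤ x^{e'}` on the box); trivially true when all coefficients are `≥ 0`;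
* otherwise slice the next variable `(i, d)`: `x_i^e = Σ_{a ≤ d} [e ≤ a]·C(d−e, a−e)·x_i^a (1−x_i)^{d−a}` (tree `SparseBernstein.pow_eq_sum_vfac`), so
  `P = Σ_a x_i^a(1−x_i)^{d−a} · P_a` with `P_a = slice1K i d a P` (exponent of `x_i` removed, equal keys merged, zero terms dropped), and
  `P ≥ 0` on the box follows from `P_a ≥ 0` on the box for every `a ≤ d` — checked recursively on the remaining variables.
This is the tensor-Bernstein criterion of `…SparseBernsteinCert` organised as a depth-first tree with early termination; on the universal
order-5 depth-3 hitting polynomial (197 terms, 25 variables, box of `2⁵·3¹⁰·4¹⁰ ≈ 2·10¹²` Bernstein profiles) it visits `6.4·10⁶` nodes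
(seat engine `code/p5d3c.py`), which is what makes the depth-3 `C₅` certificate kernel-replayable in one `native_decide`.

* `leE`, `monoK`, `monoK_anti` — pointwise order of exponent lists and antitonicity of monomials on the box;
* `insertAdd`, `mergeK`, `dropZeroK`, `sliceRaw`, `slice1K` (+ `evalKL_*` lemmas, `evalKL_slice_expand`);
* `takeFrom`, `domGo`, `dominatedK`, `dominatedK_sound`;
* **`boxcheckK`, `evalKL_nonneg_of_boxcheckK`** — soundness: `boxcheckK vs L = true`, all sliced variables `< k`, all exponents within the
  declared degrees ⟹ `0 ≤ evalKL k L x` for every `x ∈ [0,1]^k`. [this work; folklore (Bernstein subdivision / branch and bound)]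
-/

namespace Summit.CriticalPhenomena.PercolationContinuityZ3.Theorems

namespace SahiHitting

open Finset SparseBernstein

variable {k : ℕ}

/-! ## Monomials of exponent lists -/

/-- The monomial `∏_{i<k} x_i^{e_i}` of an exponent list (missing entries read as `0`). [folklore] -/
noncomputable def monoK (k : ℕ) (e : List ℕ) (x : Fin k → ℝ) : ℝ := ∏ i : Fin k, x i ^ e.getD i.1 0
/-- `evalKL` of a cons, in terms of `monoK`. [folklore] -/
theorem evalKL_cons_monoK (t : ℤ × List ℕ) (L : List (ℤ × List ℕ)) (x : Fin k → ℝ) :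
    evalKL k (t :: L) x = (t.1 : ℝ) * monoK k t.2 x + evalKL k L x := evalKL_cons' t L x
/-- `evalKL` of the empty list. [folklore] -/
theorem evalKL_nil' (x : Fin k → ℝ) : evalKL k ([] : List (ℤ × List ℕ)) x = 0 := by simp [evalKL]
/-- `evalKL` of a singleton. [folklore] -/
theorem evalKL_singleton (t : ℤ × List ℕ) (x : Fin k → ℝ) : evalKL k [t] x = (t.1 : ℝ) * monoK k t.2 x := by
  rw [evalKL_cons_monoK, evalKL_nil', add_zero]
/-- Monomials are nonnegative on the box. [folklore] -/
theorem monoK_nonneg (e : List ℕ) {x : Fin k → ℝ} (hx : ∀ i, 0 ≤ x i ∧ x i ≤ 1) : 0 ≤ monoK k e x :=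
  Finset.prod_nonneg fun i _ => pow_nonneg (hx i).1 _
/-- Monomials are at most `1` on the box. [folklore] -/
theorem monoK_le_one (e : List ℕ) {x : Fin k → ℝ} (hx : ∀ i, 0 ≤ x i ∧ x i ≤ 1) : monoK k e x ≤ 1 :=
  Finset.prod_le_one (fun i _ => pow_nonneg (hx i).1 _) fun i _ => pow_le_one₀ (hx i).1 (hx i).2
/-- Pointwise `≤` of exponent lists (missing entries read as `0`). [folklore] -/
def leE : List ℕ → List ℕ → Bool
  | [], _ => true
  | a :: as, [] => (a == 0) && leE as []
  | a :: as, b :: bs => Nat.ble a b && leE as bs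
/-- `leE` is pointwise `≤` for `getD · 0`. [folklore] -/
theorem getD_le_of_leE : ∀ (a b : List ℕ), leE a b = true → ∀ i : ℕ, a.getD i 0 ≤ b.getD i 0
  | [], b, _, i => by simp
  | a :: as, [], h, i => by
    simp only [leE, Bool.and_eq_true, beq_iff_eq] at h
    cases i with
    | zero => simp [h.1]
    | succ j => simpa using getD_le_of_leE as [] h.2 j
  | a :: as, b :: bs, h, i => by
    simp only [leE, Bool.and_eq_true, Nat.ble_eq] at h
    cases i with
    | zero => simpa using h.1
    | succ j => simpa using getD_le_of_leE as bs h.2 j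
/-- Monomials are antitone in the exponents on the box: `e' ≤ e ⟹ x^e ≤ x^{e'}`. [folklore] -/
theorem monoK_anti {a b : List ℕ} (h : leE a b = true) {x : Fin k → ℝ} (hx : ∀ i, 0 ≤ x i ∧ x i ≤ 1) :
    monoK k b x ≤ monoK k a x :=
  Finset.prod_le_prod (fun i _ => pow_nonneg (hx i).1 _) fun i _ =>
    pow_le_pow_of_le_one (hx i).1 (hx i).2 (getD_le_of_leE a b h i.1)

/-! ## Merging equal keys, dropping zero terms -/

/-- Insert a term, adding its coefficient to the first term with the same exponent list if there is one. [folklore] -/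
def insertAdd (t : ℤ × List ℕ) : List (ℤ × List ℕ) → List (ℤ × List ℕ)
  | [] => [t]
  | s :: rest => if s.2 = t.2 then (s.1 + t.1, s.2) :: rest else s :: insertAdd t rest
/-- `insertAdd` adds the value of the inserted term. [folklore] -/
theorem evalKL_insertAdd (t : ℤ × List ℕ) : ∀ (L : List (ℤ × List ℕ)) (x : Fin k → ℝ),
    evalKL k (insertAdd t L) x = (t.1 : ℝ) * monoK k t.2 x + evalKL k L x
  | [], x => by rw [insertAdd, evalKL_singleton, evalKL_nil', add_zero]
  | s :: rest, x => by
    unfold insertAdd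
    split_ifs with h
    · rw [evalKL_cons_monoK, evalKL_cons_monoK, h]; push_cast; ring
    · rw [evalKL_cons_monoK, evalKL_cons_monoK, evalKL_insertAdd t rest x]; ring
/-- Keys of `insertAdd t L` are keys of `L` or the key of `t`. [folklore] -/
theorem key_of_mem_insertAdd (t : ℤ × List ℕ) : ∀ (L : List (ℤ × List ℕ)) (u : ℤ × List ℕ),
    u ∈ insertAdd t L → u.2 = t.2 ∨ ∃ s ∈ L, u.2 = s.2
  | [], u, hu => by simp [insertAdd] at hu; exact Or.inl (by rw [hu])
  | s :: rest, u, hu => by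
    unfold insertAdd at hu
    split_ifs at hu with h
    · rcases List.mem_cons.1 hu with rfl | hu
      · exact Or.inr ⟨s, by simp, rfl⟩
      · exact Or.inr ⟨u, by simp [hu], rfl⟩
    · rcases List.mem_cons.1 hu with rfl | hu
      · exact Or.inr ⟨u, by simp, rfl⟩
      · rcases key_of_mem_insertAdd t rest u hu with h1 | ⟨s', hs', h2⟩
        · exact Or.inl h1
        · exact Or.inr ⟨s', by simp [hs'], h2⟩
/-- Merge equal keys of a term list (by repeated `insertAdd`). [folklore] -/
def mergeK : List (ℤ × List ℕ) → List (ℤ × List ℕ)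
  | [] => []
  | t :: ts => insertAdd t (mergeK ts)
/-- `mergeK` preserves the value. [folklore] -/
theorem evalKL_mergeK : ∀ (L : List (ℤ × List ℕ)) (x : Fin k → ℝ), evalKL k (mergeK L) x = evalKL k L x
  | [], x => rfl
  | t :: ts, x => by rw [mergeK, evalKL_insertAdd, evalKL_mergeK ts x, evalKL_cons_monoK]
/-- Keys of `mergeK L` are keys of `L`. [folklore] -/
theorem key_of_mem_mergeK : ∀ (L : List (ℤ × List ℕ)) (u : ℤ × List ℕ), u ∈ mergeK L → ∃ s ∈ L, u.2 = s.2
  | [], u, hu => by simp [mergeK] at hu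
  | t :: ts, u, hu => by
    rw [mergeK] at hu
    rcases key_of_mem_insertAdd t (mergeK ts) u hu with h | ⟨s, hs, h⟩
    · exact ⟨t, by simp, h⟩
    · obtain ⟨s', hs', h'⟩ := key_of_mem_mergeK ts s hs
      exact ⟨s', by simp [hs'], h.trans h'⟩
/-- Drop the terms with coefficient `0`. [folklore] -/
def dropZeroK (L : List (ℤ × List ℕ)) : List (ℤ × List ℕ) := L.filter fun t => t.1 != 0
/-- `dropZeroK` preserves the value. [folklore] -/
theorem evalKL_dropZeroK (L : List (ℤ × List ℕ)) (x : Fin k → ℝ) : evalKL k (dropZeroK L) x = evalKL k L x := by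
  induction L with
  | nil => rfl
  | cons t ts ih =>
    unfold dropZeroK at ih ⊢
    rw [List.filter_cons]
    by_cases h : t.1 = 0
    · have hb : (t.1 != 0) = false := by simp [h]
      simp only [hb, Bool.false_eq_true, ↓reduceIte]
      rw [evalKL_cons_monoK, h, ih]; push_cast; ring
    · have hb : (t.1 != 0) = true := by simpa [bne_iff_ne] using h
      simp only [hb, ↓reduceIte]
      rw [evalKL_cons_monoK, evalKL_cons_monoK, ih]
/-- Members of `dropZeroK L` are members of `L`. [folklore] -/
theorem mem_of_mem_dropZeroK {L : List (ℤ × List ℕ)} {u : ℤ × List ℕ} (hu : u ∈ dropZeroK L) : u ∈ L :=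
  (List.mem_filter.1 hu).1

/-! ## Bernstein extraction in one variable -/

/-- Setting entry `i` to `0` and reading entries back. [folklore] -/
theorem getD_set_zero : ∀ (l : List ℕ) (i j : ℕ), (l.set i 0).getD j 0 = if i = j then 0 else l.getD j 0
  | [], i, j => by simp
  | a :: as, 0, 0 => by simp
  | a :: as, 0, j + 1 => by simp
  | a :: as, i + 1, 0 => by simp
  | a :: as, i + 1, j + 1 => by
    simp only [List.set_cons_succ, List.getD_cons_succ, getD_set_zero as i j, add_left_inj]
/-- The monomial with exponent `i` removed, times `x_i^{e_i}`, is the monomial. [folklore] -/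
theorem monoK_set_mul (e : List ℕ) {i : ℕ} (hi : i < k) (x : Fin k → ℝ) :
    monoK k (e.set i 0) x * x ⟨i, hi⟩ ^ e.getD i 0 = monoK k e x := by
  unfold monoK
  rw [← Finset.mul_prod_erase Finset.univ (fun j : Fin k => x j ^ (e.set i 0).getD j.1 0) (Finset.mem_univ ⟨i, hi⟩),
    ← Finset.mul_prod_erase Finset.univ (fun j : Fin k => x j ^ e.getD j.1 0) (Finset.mem_univ ⟨i, hi⟩)]
  have h1 : (e.set i 0).getD i 0 = 0 := by rw [getD_set_zero]; simp
  have h2 : ∏ j ∈ Finset.univ.erase (⟨i, hi⟩ : Fin k), x j ^ (e.set i 0).getD j.1 0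
      = ∏ j ∈ Finset.univ.erase (⟨i, hi⟩ : Fin k), x j ^ e.getD j.1 0 := by
    refine Finset.prod_congr rfl fun j hj => ?_
    have hne : i ≠ j.1 := fun h => (Finset.ne_of_mem_erase hj) (Fin.ext h.symm)
    rw [getD_set_zero, if_neg hne]
  simp only [h1, pow_zero, one_mul]
  rw [h2, mul_comm]
/-- Raw scaled Bernstein extraction in variable `i` (degree `d`, index `a`): terms with `e_i ≤ a`, coefficient times `C(d−e_i, a−e_i)`,
exponent `e_i` removed. [folklore] -/
def sliceRaw (i d a : ℕ) (L : List (ℤ × List ℕ)) : List (ℤ × List ℕ) :=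
  L.filterMap fun t => if t.2.getD i 0 ≤ a then some (t.1 * ((d - t.2.getD i 0).choose (a - t.2.getD i 0) : ℕ), t.2.set i 0) else none
/-- Scaled Bernstein extraction in variable `i`, degree `d`, index `a`, with merged keys and no zero terms. [folklore] -/
def slice1K (i d a : ℕ) (L : List (ℤ × List ℕ)) : List (ℤ × List ℕ) := dropZeroK (mergeK (sliceRaw i d a L))
/-- Keys of a slice are keys of the input with entry `i` set to `0`. [folklore] -/
theorem key_of_mem_slice1K {i d a : ℕ} {L : List (ℤ × List ℕ)} {u : ℤ × List ℕ} (hu : u ∈ slice1K i d a L) :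
    ∃ t ∈ L, u.2 = t.2.set i 0 := by
  obtain ⟨s, hs, h⟩ := key_of_mem_mergeK _ u (mem_of_mem_dropZeroK hu)
  unfold sliceRaw at hs
  rw [List.mem_filterMap] at hs
  obtain ⟨t, ht, hts⟩ := hs
  split_ifs at hts with hle
  · refine ⟨t, ht, ?_⟩
    rw [h, ← Option.some_inj.1 hts]
/-- **The one-variable Bernstein expansion of a term list**: `P(x) = Σ_{a ≤ d} x_i^a (1−x_i)^{d−a} · (slice1K i d a P)(x)` when every
exponent of `x_i` is `≤ d`. [folklore] -/
theorem evalKL_slice_expand {i : ℕ} (hi : i < k) (d : ℕ) : ∀ (L : List (ℤ × List ℕ)), (∀ t ∈ L, t.2.getD i 0 ≤ d) → ∀ x : Fin k → ℝ,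
    evalKL k L x = ∑ a ∈ Finset.range (d + 1), (x ⟨i, hi⟩ ^ a * (1 - x ⟨i, hi⟩) ^ (d - a)) * evalKL k (slice1K i d a L) x
  | [], _, x => by
    simp [slice1K, sliceRaw, mergeK, dropZeroK, evalKL]
  | t :: ts, hdeg, x => by
    have hts : ∀ s ∈ ts, s.2.getD i 0 ≤ d := fun s hs => hdeg s (by simp [hs])
    have ht : t.2.getD i 0 ≤ d := hdeg t (by simp)
    have ih := evalKL_slice_expand hi d ts hts x
    -- value of the slices of `t :: ts`
    have hval : ∀ a, evalKL k (slice1K i d a (t :: ts)) x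
        = (if t.2.getD i 0 ≤ a then (t.1 : ℝ) * ((d - t.2.getD i 0).choose (a - t.2.getD i 0) : ℕ) * monoK k (t.2.set i 0) x else 0)
          + evalKL k (slice1K i d a ts) x := by
      intro a
      unfold slice1K
      rw [evalKL_dropZeroK, evalKL_mergeK, evalKL_dropZeroK, evalKL_mergeK]
      unfold sliceRaw
      rw [List.filterMap_cons]
      split_ifs with hle
      · rw [evalKL_cons_monoK]; push_cast; ring
      · rw [zero_add]
    simp_rw [hval, mul_add, Finset.sum_add_distrib, ← ih, evalKL_cons_monoK]
    congr 1
    -- the single term: `c · x^e = Σ_a bern_a · [e ≤ a] C(d−e,a−e) · c · x^{e with i removed}`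
    rw [← monoK_set_mul t.2 hi x, pow_eq_sum_vfac (x ⟨i, hi⟩) ht, Finset.mul_sum, Finset.mul_sum]
    refine Finset.sum_congr rfl fun a _ => ?_
    unfold vfac
    split_ifs with hle
    · push_cast; ring
    · simp

/-! ## The domination leaf test -/

/-- Take up to `need` units of budget from the positive terms of `P` whose exponents are pointwise `≤ e`; returns (amount taken, new budgets).
[this work] -/
def takeFrom (e : List ℕ) : List (ℤ × List ℕ) → ℕ → ℕ × List (ℤ × List ℕ)
  | [], _ => (0, [])
  | p :: P, need =>
      if need = 0 then (0, p :: P)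
      else if 0 < p.1 ∧ leE p.2 e = true then
        let tk := min p.1.toNat need
        let r := takeFrom e P (need - tk)
        (tk + r.1, (p.1 - tk, p.2) :: r.2)
      else
        let r := takeFrom e P need
        (r.1, p :: r.2)
/-- `takeFrom` never takes more than asked. [this work] -/
theorem takeFrom_le (e : List ℕ) : ∀ (P : List (ℤ × List ℕ)) (need : ℕ), (takeFrom e P need).1 ≤ need
  | [], need => by simp [takeFrom]
  | p :: P, need => by
    unfold takeFrom
    split_ifs with h0 h1
    · simp
    · have := takeFrom_le e P (need - min p.1.toNat need)
      simp only
      omega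
    · exact takeFrom_le e P need
/-- `takeFrom` keeps the budgets nonnegative and pays for `taken · x^e` out of the value of `P` on the box. [this work] -/
theorem takeFrom_spec (e : List ℕ) {x : Fin k → ℝ} (hx : ∀ i, 0 ≤ x i ∧ x i ≤ 1) :
    ∀ (P : List (ℤ × List ℕ)) (need : ℕ), (∀ p ∈ P, 0 ≤ p.1) →
      (∀ p ∈ (takeFrom e P need).2, 0 ≤ p.1) ∧
        evalKL k (takeFrom e P need).2 x + ((takeFrom e P need).1 : ℝ) * monoK k e x ≤ evalKL k P x
  | [], need, _ => by simp [takeFrom, evalKL_nil']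
  | p :: P, need, hP => by
    have hp : 0 ≤ p.1 := hP p (by simp)
    have hP' : ∀ q ∈ P, 0 ≤ q.1 := fun q hq => hP q (by simp [hq])
    unfold takeFrom
    split_ifs with h0 h1
    · refine ⟨hP, ?_⟩; simp
    · obtain ⟨ihA, ihB⟩ := takeFrom_spec e hx P (need - min p.1.toNat need) hP'
      have hle : min p.1.toNat need ≤ p.1.toNat := min_le_left _ _
      generalize htk : min p.1.toNat need = tk at ihA ihB hle ⊢
      refine ⟨?_, ?_⟩
      · intro q hq
        simp only [List.mem_cons] at hq
        rcases hq with rfl | hq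
        · simp only [sub_nonneg]
          have h1' : (tk : ℤ) ≤ p.1.toNat := by exact_mod_cast hle
          have h2 : (p.1.toNat : ℤ) = p.1 := Int.toNat_of_nonneg hp
          omega
        · exact ihA q hq
      · rw [evalKL_cons_monoK, evalKL_cons_monoK]
        have hmono : monoK k e x ≤ monoK k p.2 x := monoK_anti h1.2 hx
        have htk0 : (0 : ℝ) ≤ (tk : ℝ) := by positivity
        have key : (tk : ℝ) * monoK k e x ≤ (tk : ℝ) * monoK k p.2 x := mul_le_mul_of_nonneg_left hmono htk0
        push_cast
        linarith [key, ihB]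
    · obtain ⟨ihA, ihB⟩ := takeFrom_spec e hx P need hP'
      refine ⟨?_, ?_⟩
      · intro q hq
        simp only [List.mem_cons] at hq
        rcases hq with rfl | hq
        · exact hp
        · exact ihA q hq
      · rw [evalKL_cons_monoK, evalKL_cons_monoK]
        linarith [ihB]
/-- Greedy domination: process the terms; each negative term `−a x^e` must be fully paid by budget from positive terms with exponents `≤ e`.
[this work] -/
def domGo : List (ℤ × List ℕ) → List (ℤ × List ℕ) → Bool
  | [], _ => true
  | t :: ts, P =>
      if 0 ≤ t.1 then domGo ts P
      else
        let r := takeFrom t.2 P (-t.1).toNat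
        (r.1 == (-t.1).toNat) && domGo ts r.2
/-- Soundness of `domGo`: the budgets plus the negative terms processed are `≥ 0` on the box. [this work] -/
theorem domGo_sound {x : Fin k → ℝ} (hx : ∀ i, 0 ≤ x i ∧ x i ≤ 1) :
    ∀ (ts P : List (ℤ × List ℕ)), (∀ p ∈ P, 0 ≤ p.1) → domGo ts P = true →
      0 ≤ evalKL k P x + evalKL k (ts.filter fun t => decide (t.1 < 0)) x
  | [], P, hP, _ => by
    rw [List.filter_nil, evalKL_nil', add_zero]
    unfold evalKL
    refine List.sum_nonneg ?_
    intro v hv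
    rw [List.mem_map] at hv
    obtain ⟨p, hp, rfl⟩ := hv
    exact mul_nonneg (by exact_mod_cast hP p hp) (monoK_nonneg p.2 hx)
  | t :: ts, P, hP, h => by
    unfold domGo at h
    rw [List.filter_cons]
    split_ifs at h with ht
    · have : ¬ (t.1 < 0) := not_lt.2 ht
      simp only [this, decide_false, Bool.false_eq_true, ↓reduceIte]
      exact domGo_sound hx ts P hP h
    · have hneg : t.1 < 0 := lt_of_not_ge ht
      simp only [hneg, decide_true, ↓reduceIte]
      simp only [Bool.and_eq_true, beq_iff_eq] at h
      obtain ⟨h1, h2⟩ := h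
      obtain ⟨hA, hB⟩ := takeFrom_spec t.2 hx P (-t.1).toNat hP
      have ih := domGo_sound hx ts _ hA h2
      rw [h1] at hB
      have hc : (((-t.1).toNat : ℕ) : ℝ) = -(t.1 : ℝ) := by
        have : (((-t.1).toNat : ℕ) : ℤ) = -t.1 := Int.toNat_of_nonneg (by omega)
        exact_mod_cast this
      rw [evalKL_cons_monoK]
      rw [hc] at hB
      linarith
/-- **The domination test** on a term list: budgets = its positive terms. [this work] -/
def dominatedK (L : List (ℤ × List ℕ)) : Bool := domGo L (L.filter fun t => decide (0 < t.1))
/-- Splitting the value into positive and negative terms. [folklore] -/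
theorem evalKL_split : ∀ (L : List (ℤ × List ℕ)) (x : Fin k → ℝ),
    evalKL k L x = evalKL k (L.filter fun t => decide (0 < t.1)) x + evalKL k (L.filter fun t => decide (t.1 < 0)) x
  | [], x => by simp [evalKL_nil']
  | t :: ts, x => by
    rw [evalKL_cons_monoK, List.filter_cons, List.filter_cons, evalKL_split ts x]
    rcases lt_trichotomy t.1 0 with h | h | h
    · have h' : ¬ (0 < t.1) := not_lt.2 h.le
      simp only [h', decide_false, Bool.false_eq_true, ↓reduceIte, h, decide_true, evalKL_cons_monoK]
      ring
    · simp [h]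
    · have h' : ¬ (t.1 < 0) := not_lt.2 h.le
      simp only [h, decide_true, ↓reduceIte, h', decide_false, Bool.false_eq_true, evalKL_cons_monoK]
      ring
/-- **Soundness of the domination test**: `dominatedK L ⟹ 0 ≤ evalKL k L x` on the box. [this work] -/
theorem dominatedK_sound {L : List (ℤ × List ℕ)} (h : dominatedK L = true) {x : Fin k → ℝ} (hx : ∀ i, 0 ≤ x i ∧ x i ≤ 1) :
    0 ≤ evalKL k L x := by
  rw [evalKL_split L x]
  refine domGo_sound hx L _ (fun p hp => ?_) h
  have := (List.mem_filter.1 hp).2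
  simp only [decide_eq_true_eq] at this
  exact this.le

/-! ## The recursive checker -/

/-- **Pruned recursive Bernstein slicing**: domination test at every node, else slice the next (variable, degree) and recurse on every index.
[this work] -/
def boxcheckK : List (ℕ × ℕ) → List (ℤ × List ℕ) → Bool
  | [], L => dominatedK L
  | vd :: vs, L => dominatedK L || (List.range (vd.2 + 1)).all fun a => boxcheckK vs (slice1K vd.1 vd.2 a L)
/-- **Soundness of `boxcheckK`**: with all sliced variables `< k` and all exponents within the declared degrees, `boxcheckK vs L = true`
gives `0 ≤ evalKL k L x` on the unit box. [this work] -/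
theorem evalKL_nonneg_of_boxcheckK : ∀ (vs : List (ℕ × ℕ)) (L : List (ℤ × List ℕ)),
    boxcheckK vs L = true → (∀ vd ∈ vs, vd.1 < k) → (∀ t ∈ L, ∀ vd ∈ vs, t.2.getD vd.1 0 ≤ vd.2) →
      ∀ x : Fin k → ℝ, (∀ i, 0 ≤ x i ∧ x i ≤ 1) → 0 ≤ evalKL k L x
  | [], L, h, _, _, x, hx => dominatedK_sound (by simpa [boxcheckK] using h) hx
  | vd :: vs, L, h, hk, hdeg, x, hx => by
    unfold boxcheckK at h
    rw [Bool.or_eq_true] at h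
    rcases h with h | h
    · exact dominatedK_sound h hx
    · have hi : vd.1 < k := hk vd (by simp)
      rw [evalKL_slice_expand hi vd.2 L (fun t ht => hdeg t ht vd (by simp)) x]
      refine Finset.sum_nonneg fun a ha => mul_nonneg (mul_nonneg (pow_nonneg (hx _).1 _) (pow_nonneg (sub_nonneg.2 (hx _).2) _)) ?_
      rw [List.all_eq_true] at h
      have hcheck : boxcheckK vs (slice1K vd.1 vd.2 a L) = true := h a (by simpa using ha)
      refine evalKL_nonneg_of_boxcheckK vs _ hcheck (fun vd' hvd' => hk vd' (by simp [hvd'])) (fun u hu vd' hvd' => ?_) x hx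
      obtain ⟨t, ht, hkey⟩ := key_of_mem_slice1K hu
      rw [hkey, getD_set_zero]
      split_ifs
      · exact Nat.zero_le _
      · exact hdeg t ht vd' (by simp [hvd'])

end SahiHitting

end Summit.CriticalPhenomena.PercolationContinuityZ3.Theorems
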